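import Mathlib.NumberTheory.LegendreSymbol.QuadraticReciprocity
import Literature.NumberTheory.QuadraticFields.KroneckerSplitting
import Mathlib.Data.Fintype.Card
import Mathlib.Tactic.NormNum
import HarnessLib

/-!
# Venture HSemireg — square roots modulo an odd prime: `#{x ∈ ℤ∕ℓ : x² = a} ∈ {0, 2}` for `a ≠ 0`, and for `a = −2` the count is `2` iff
# `ℓ ≡ 1, 3 (mod 8)` — the prime-level input of «`2^{ω(d′)}`» (THEOREM 35-B, ENGINE-W PROBE5 §35 (3)) — kernel number theory

HONEST FRAMING. Lean index of the computation cell `pub-hsemireg`, widening group ENGINE-W (code A, seat `engine-w-1`, gen 17).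
ELEMENTARY NUMBER THEORY over the field `ℤ∕ℓ` plus Mathlib's second supplement `ZMod.exists_sq_eq_neg_two_iff`; no abelian variety,
sheaf, `Ext` group, secant structure or semiregularity map is constructed; nothing here says that HC, HC_CM or HC_AV holds. Theorems only
(0 `def`, 0 named fact, 0 `sorry`). New namespace `SqrtModPrime`; companions `HenselSquareRoots.lean` (prime powers), `SquareRootCountCRT.lean`
(coprime products), `TargetResidueCounts.lean` (enumerations).

SOURCE (the cell's own result): `widen/ENGINE-W/out/probe5/PROBE5-STIZ-A.md` §35 (3) THEOREM 35-B «the residues `A mod d` with `A² ≡ −2` number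
`2^{ω(d′)}`» — at a prime `ℓ ∣ d′` (`ℓ` odd; `ℓ ∣ A² + 2` for an admissible target, so `−2` IS a square mod `ℓ`) there are exactly TWO roots.
What the kernel holds (`ℓ` an odd prime, `a ∈ ℤ∕ℓ`):

* §1 **`sq_eq_iff_of_root`** — if `r² = a` then `x² = a ⟺ x = r ∨ x = −r`; **`card_sqrts_eq_two`** — `a ≠ 0` with a root ⟹ exactly `2` roots
  (`r ≠ −r` as `2 ≠ 0` — the landed `Literature.NumberTheory.QuadraticFields.Quadratic.two_ne_zero_zmod`, REUSED); **`card_sqrts_eq_zero`** — no root ⟹ `0`; so the count is `0` or `2` (`card_sqrts_zero_or_two`).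
* §2 **`card_sqrts_neg_two`** — for `a = −2`: the count is `2` if `ℓ % 8 ∈ {1, 3}` and `0` otherwise (Mathlib's `ZMod.exists_sq_eq_neg_two_iff`);
  instances `ℓ = 3, 11, 17, 19 ↦ 2` (the primes of record: `3, 3, 1, 3 mod 8`) and `ℓ = 5, 7, 13 ↦ 0`.
WHAT IS NOT HERE: the assembly over the factorisation of `d` (use `HenselSqrt.card_sqrt_pow` and `RootCountCRT.natCard_sq_list_prod`).
-/

namespace Summit.Ventures.HSemireg.SqrtModPrime

/-! ## §1 Zero or two roots -/

/-- In the field `ℤ∕ℓ`: if `r² = a` then `x² = a ⟺ x = r ∨ x = −r` (`(x − r)(x + r) = 0`). [kernel] -/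
theorem sq_eq_iff_of_root {p : ℕ} [Fact p.Prime] {a r : ZMod p} (hr : r ^ 2 = a) (x : ZMod p) :
    x ^ 2 = a ↔ x = r ∨ x = -r := by
  constructor
  · intro hx
    have h0 : (x - r) * (x + r) = 0 := by linear_combination hx - hr
    rcases mul_eq_zero.1 h0 with h | h
    · exact Or.inl (sub_eq_zero.1 h)
    · exact Or.inr (eq_neg_of_add_eq_zero_left h)
  · rintro (rfl | rfl)
    · exact hr
    · rw [neg_sq]; exact hr

/-- **Exactly two roots**: `a ≠ 0`, `ℓ` odd, and one root `r` ⟹ `|{x : ℤ∕ℓ // x² = a}| = 2` (the roots are `r ≠ −r`). [kernel] -/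
theorem card_sqrts_eq_two {p : ℕ} [Fact p.Prime] (hodd : p ≠ 2) {a r : ZMod p} (hr : r ^ 2 = a) (ha : a ≠ 0) :
    Fintype.card {x : ZMod p // x ^ 2 = a} = 2 := by
  classical
  have hr0 : r ≠ 0 := by rintro rfl; apply ha; rw [← hr]; ring
  have hne : r ≠ -r := by
    intro h
    have h2 : (2 : ZMod p) * r = 0 := by linear_combination h
    rcases mul_eq_zero.1 h2 with h | h
    · exact Literature.NumberTheory.QuadraticFields.Quadratic.two_ne_zero_zmod hodd h
    · exact hr0 h
  rw [Fintype.card_of_subtype ({r, -r} : Finset (ZMod p))]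
  · exact Finset.card_pair hne
  · intro x
    rw [Finset.mem_insert, Finset.mem_singleton]
    exact (sq_eq_iff_of_root hr x).symm

/-- **No root**: if `a` is not a square in `ℤ∕ℓ` then `|{x // x² = a}| = 0`. [kernel] -/
theorem card_sqrts_eq_zero {p : ℕ} [Fact p.Prime] {a : ZMod p} (ha : ¬ IsSquare a) :
    Fintype.card {x : ZMod p // x ^ 2 = a} = 0 := by
  rw [Fintype.card_eq_zero_iff]
  refine ⟨fun ⟨x, hx⟩ => ha ⟨x, ?_⟩⟩
  rw [← hx]; ring

/-- Hence the count is `0` or `2` for `a ≠ 0`, `ℓ` odd. [kernel] -/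
theorem card_sqrts_zero_or_two {p : ℕ} [Fact p.Prime] (hodd : p ≠ 2) {a : ZMod p} (ha : a ≠ 0) :
    Fintype.card {x : ZMod p // x ^ 2 = a} = 0 ∨ Fintype.card {x : ZMod p // x ^ 2 = a} = 2 := by
  by_cases h : IsSquare a
  · obtain ⟨r, hr⟩ := h
    exact Or.inr (card_sqrts_eq_two hodd (r := r) (by rw [hr]; ring) ha)
  · exact Or.inl (card_sqrts_eq_zero h)

/-! ## §2 `a = −2`: two roots iff `ℓ ≡ 1, 3 (mod 8)` -/

/-- **The prime-level count for `−2`**: for an odd prime `ℓ`, `|{x ∈ ℤ∕ℓ : x² = −2}|` is `2` if `ℓ % 8 = 1` or `ℓ % 8 = 3`, and `0` otherwise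
(second supplement; `−2 ≠ 0` as `ℓ ≠ 2`). [kernel] -/
theorem card_sqrts_neg_two (p : ℕ) [Fact p.Prime] (hodd : p ≠ 2) :
    Fintype.card {x : ZMod p // x ^ 2 = -2} = if p % 8 = 1 ∨ p % 8 = 3 then 2 else 0 := by
  have hne : (-2 : ZMod p) ≠ 0 := neg_ne_zero.2 (Literature.NumberTheory.QuadraticFields.Quadratic.two_ne_zero_zmod hodd)
  split_ifs with h
  · obtain ⟨r, hr⟩ := (ZMod.exists_sq_eq_neg_two_iff hodd).2 h
    exact card_sqrts_eq_two hodd (r := r) (by rw [hr]; ring) hne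
  · exact card_sqrts_eq_zero (fun hsq => h ((ZMod.exists_sq_eq_neg_two_iff hodd).1 hsq))

/-- **The primes of record** `3, 11, 17, 19` (`≡ 3, 3, 1, 3 (mod 8)`) carry two roots of `−2`; `5, 7, 13` (`≡ 5, 7, 5`) none. [kernel] -/
theorem primes_of_record :
    (3 % 8 = 3 ∧ 11 % 8 = 3 ∧ 17 % 8 = 1 ∧ 19 % 8 = 3) ∧ (5 % 8 = 5 ∧ 7 % 8 = 7 ∧ 13 % 8 = 5) ∧
    Fintype.card {x : ZMod 3 // x ^ 2 = -2} = 2 ∧ Fintype.card {x : ZMod 11 // x ^ 2 = -2} = 2 ∧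
    Fintype.card {x : ZMod 17 // x ^ 2 = -2} = 2 ∧ Fintype.card {x : ZMod 19 // x ^ 2 = -2} = 2 ∧
    Fintype.card {x : ZMod 5 // x ^ 2 = -2} = 0 ∧ Fintype.card {x : ZMod 7 // x ^ 2 = -2} = 0 ∧
    Fintype.card {x : ZMod 13 // x ^ 2 = -2} = 0 := by
  refine ⟨by decide, by decide, ?_, ?_, ?_, ?_, ?_, ?_, ?_⟩ <;> decide +kernel

end Summit.Ventures.HSemireg.SqrtModPrime
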